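/-
Copyright (c) 2026. All rights reserved.
Released under Apache 2.0 license as described in the file LICENSE.
-/
import Literature.Geometry.Kaehler.ComplexTorusQuaternionAutomorphismsComplexStructure
import Literature.Geometry.Kaehler.ComplexTorusCyclotomicAutomorphismFixedPoints
import HarnessLib

/-!
# Fixed points of `Aut(A(τ), ι)`: the order-`4` automorphisms `±J_τ` of a `Z(1)`-member of Lang's quaternionic
# family have exactly `4` fixed points, all of them `2`-torsion (`Φ₄(J_τ) = 0`, `det(1 − J_τ) = Φ₄(1)² = 4`),
# every translate `t_c ∘ (±J_τ)` has `4` fixed points, and `−1` has the `16` points of `A(τ)[2]`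
# (Dolgachev–Zarhin 2024 §2.2; Lange 2023 Prop. 1.1.13; Kudla–Rapoport–Yang 2006 §3.4)

[tag: complex_torus] [tag: abelian_surface] [tag: quaternion_multiplication] [tag: automorphism_group]
[tag: fixed_points] [tag: shimura_curve] [tag: special_cycles]

Lane `lit-hodgefound`, seat p12, row g27-#7 — the fixed-point census of the automorphism group computed in
g27-#1/#5/#6 (`Aut(A(τ), ι) = End(A(τ), ι) ∩ {±1, ±J_τ}`, `…QuaternionAutomorphismsComplexStructure`:
`map_coe_eq_or_of_isUnit`, `natCard_units_eq_four_iff_exists_map_coe_eq_jMatrix`), read through the tree's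
cyclotomic fixed-point machinery (`…CyclotomicAutomorphismFixedPoints`: `fixedSubgroup`, `natCard_fixedSubgroup`,
`det_one_sub_eq_pow`, `eval_one_cyclotomic_zsmul_eq_zero` — Dolgachev–Zarhin's `A^δ ≅ Λ/(1 − δ)Λ`,
`#A^δ = |det(1 − ρ_r(δ))| = Φ_n(1)^{rk Λ/φ(n)}`) and the Lefschetz count (`…LefschetzNumber`:
`natCard_fixedPoints_mapMatrix`, `natCard_fixedPoints_mapMatrix_add`). For `u` with `ρ_r(u) = ±J_τ`: `u² = −1`,
i.e. `Φ₄(u) = u² + 1 = 0` (`n = 4 = 2²`, `φ(4) = 2`, `Φ₄(1) = 2`), so `det(1 − u) = 2^{4/2} = 4`, `#Fix(u) = 4`,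
`Fix(u) ⊆ A(τ)[2]`, `Fix(u) = Fix(−u)`, and every translate `x ↦ u(x) + c` has `4` fixed points as well; `−1`
fixes exactly `A(τ)[2]`, `16` points. Nothing restated; tree results used BY NAME.

## The print, VERBATIM

I. Dolgachev, Yu. Zarhin, *Endomorphisms of Complex Abelian Varieties* (2024 notes) [DolgachevZarhin2024] §2.2
(held `paper:galaxy-pdf-8712177384607648460`, chunks p0033–p0034): «the subgroup of fixed points of `δ`»,
«`A^δ = {x ∈ A ∣ δ(x) = x}`», «`A^δ = (1−δ)⁻¹Λ/Λ ≅ Λ/(1−δ)Λ`», «`dim_{𝔽_ℓ}(A^δ) = r = 2dim(A)/(ℓ−1)`».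
H. Lange (2023) [Lange2023AbelianVarietiesComplex] §1.1.2 Prop. 1.1.13 (`deg f = |det ρ_r(f)|`), §2.4.1
Prop. 2.4.3 (b). S. Kudla, M. Rapoport, T. Yang (2006) [KudlaRapoportYang2006] §3.4 (3.4.7) p. 53: «`x̃ = r(j_x)`»,
«`j_x ∈ V ∩ O_B` with `j_x² = −t`» (for `t = 1` the special endomorphism `x̃` is an automorphism with
`x̃² = −1`), §3.2 p. 48: «the automorphisms of `(A_z, ι_z)` are given by elements in `Γ_z`».

## What is proved (theorems only; no definition, no named fact, no instance)

Namespace `…ComplexTorus.QuaternionType`; `a ≠ 0 < b`, `τ ∈ ℂ ∖ ℝ`, `Φ = period a b ha hb hτ`, `J_τ = jMatrix Φ`,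
`M ∈ M₄(ℤ)` with `M_ℝ = ±J_τ` (the rational representation of an order-`4` automorphism of `(A(τ), ι)`, g27-#6):
`mul_self_eq_neg_one_of_map_eq` (`M² = −1`), `aeval_cyclotomic_four_eq_zero` (`Φ₄(M) = 0`, stated with
`4 = 2^{1+1}` as the tree's prime-power lemmas want it), **`det_one_sub_eq_four`** (`det(1 − M) = 4`),
**`natCard_fixedPoints_eq_four`** (`#Fix(ρ(M)) = 4`), `natCard_fixedPoints_add_eq_four` (every translate
`x ↦ ρ(M)x + c` has exactly `4` fixed points), **`two_zsmul_eq_zero_of_mapMatrix_eq`** (`Fix ⊆ A(τ)[2]`),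
**`fixedPoints_eq_fixedPoints_neg`** (`Fix(M) = Fix(−M)`), `natCard_fixedPoints_of_isUnit` (for every unit
`u ≠ 1` of `End(A(τ), ι)`: `#Fix(u) = 16` if `u = −1`, else `4`), `exists_natCard_fixedPoints_eq_four_of_natCard_eq_four`
(at a `Z(1)`-point there is an automorphism of `(A(τ), ι)` with `u² = −1`, `4` fixed points, all `2`-torsion);
validation `(−1,3)`, `τ = i`: `natCard_fixedPoints_rmulInt_I_neg_one_three_I` (`R_i` has `4` fixed points on `A(i)`).

## Honest scope

Fixed points of the group endomorphisms `mapMatrix Φ Φ M` of the complex torus (and their translates), counted as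
`Nat.card` of the fixed-point SET (finite here); `2`-torsion as `(2 : ℤ) • t = 0`; no statement about the quotient
`A(τ)/⟨u⟩` or its singularities. Everything is proved; 0 definitions, 0 named facts, 0 instances.

## References
* [DolgachevZarhin2024] I. Dolgachev, Yu. G. Zarhin, Endomorphisms of Complex Abelian Varieties, lecture notes
  (2024), §2.2.
* [Lange2023AbelianVarietiesComplex] H. Lange, Abelian Varieties over the Complex Numbers (2023), §1.1.2
  Prop. 1.1.13, §2.4.1 Prop. 2.4.3 (b).
* [KudlaRapoportYang2006] S. Kudla, M. Rapoport, T. Yang, Modular Forms and Special Cycles on Shimura Curves (2006),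
  §3.2 Prop. 3.2.1 p. 48, §3.4 (3.4.6)–(3.4.7).
* [FarmakisMoskowitz2013] I. Farmakis, M. Moskowitz, Fixed Point Theorems and Their Applications (2013), §5.5.1
  Thm. 5.5.5.
-/

noncomputable section

open Complex Module Matrix Quaternion Function Polynomial
open scoped Manifold ContDiff Real

namespace Literature.Geometry.Kaehler.ComplexTorus.QuaternionType

section FixedPoints

variable {a b : ℤ} {τ : ℂ} (ha : a ≠ 0) (hb : 0 < b) (hτ : τ.im ≠ 0)

/-- Entrywise cast of a product of integer matrices. [folklore] -/
private theorem map_intCast_mul_aux (A B : Matrix (Fin 4) (Fin 4) ℤ) :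
    (A * B).map (Int.cast : ℤ → ℝ) = A.map (Int.cast : ℤ → ℝ) * B.map (Int.cast : ℤ → ℝ) :=
  Matrix.map_mul (f := Int.castRingHom ℝ)

/-- Entrywise cast of `−A`. [folklore] -/
private theorem map_intCast_neg_aux (A : Matrix (Fin 4) (Fin 4) ℤ) :
    (-A).map (Int.cast : ℤ → ℝ) = -A.map (Int.cast : ℤ → ℝ) :=
  Matrix.map_neg _ (fun x ↦ Int.cast_neg x) A

/-- `1.map = 1`. [folklore] -/
private theorem map_intCast_one_aux : (1 : Matrix (Fin 4) (Fin 4) ℤ).map (Int.cast : ℤ → ℝ) = 1 :=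
  Matrix.map_one Int.cast Int.cast_zero Int.cast_one

/-- **`M_ℝ = ±J_τ ⟹ M² = −1`** (`J² = −1`, and `ρ_r` is faithful). [cite: Lang1982AbelianFunctions, Ch. IX §4 Thm. 4.3 (proof: «`η² = −1`»)] [cite: KudlaRapoportYang2006, §3.4 (3.4.7) p. 53 («`j_x² = −t`»)] -/
theorem mul_self_eq_neg_one_of_map_eq {M : Matrix (Fin 4) (Fin 4) ℤ}
    (hJ : M.map (Int.cast : ℤ → ℝ) = jMatrix (period a b ha hb hτ) ∨
      M.map (Int.cast : ℤ → ℝ) = -jMatrix (period a b ha hb hτ)) : M * M = -1 := by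
  refine Matrix.map_injective (Int.cast_injective (α := ℝ)) ?_
  show (M * M).map (Int.cast : ℤ → ℝ) = (-1 : Matrix (Fin 4) (Fin 4) ℤ).map (Int.cast : ℤ → ℝ)
  rw [map_intCast_mul_aux, map_intCast_neg_aux, map_intCast_one_aux]
  rcases hJ with h | h <;> rw [h]
  · exact jMatrix_mul_jMatrix _
  · rw [neg_mul_neg, jMatrix_mul_jMatrix]

/-- **`Φ₄(M) = M² + 1 = 0`** for `M² = −1` (`Φ_{2²} = 1 + X²`; stated with `4 = 2^{1+1}`, the shape of the tree's
prime-power lemmas). [cite: DolgachevZarhin2024, §2.2 (2.15) (chunk p0033)] -/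
theorem aeval_cyclotomic_four_eq_zero {M : Matrix (Fin 4) (Fin 4) ℤ} (hM : M * M = -1) :
    aeval M (cyclotomic (2 ^ (1 + 1)) ℤ) = 0 := by
  rw [cyclotomic_prime_pow_eq_geom_sum Nat.prime_two, Finset.sum_range_succ, Finset.sum_range_one, pow_zero,
    pow_one, pow_one, map_add, map_one, map_pow, aeval_X, sq, hM, add_neg_cancel]

/-- **`det(1 − M) = Φ₄(1)^{4/φ(4)} = 2² = 4`** for `M_ℝ = ±J_τ` (the tree's `det_one_sub_eq_pow`).
[cite: DolgachevZarhin2024, §2.2 («`A^δ = (1−δ)⁻¹Λ/Λ ≅ Λ/(1−δ)Λ`», chunk p0034)] [cite: Lange2023AbelianVarietiesComplex, §1.1.2 Prop. 1.1.13] -/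
theorem det_one_sub_eq_four {M : Matrix (Fin 4) (Fin 4) ℤ}
    (hJ : M.map (Int.cast : ℤ → ℝ) = jMatrix (period a b ha hb hτ) ∨
      M.map (Int.cast : ℤ → ℝ) = -jMatrix (period a b ha hb hτ)) : (1 - M).det = 4 := by
  have hD := aeval_cyclotomic_four_eq_zero (mul_self_eq_neg_one_of_map_eq ha hb hτ hJ)
  have ht : (2 ^ (1 + 1) : ℕ).totient = 2 := by decide
  rw [det_one_sub_eq_pow (pow_pos Nat.prime_two.pos _) hD, eval_one_cyclotomic_prime_pow, Fintype.card_fin, ht]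
  norm_num

/-- **The order-`4` automorphisms `±J_τ` of `(A(τ), ι)` have exactly `4` fixed points**
(`#Fix = |det(1 − ρ_r)| = 4`). [cite: DolgachevZarhin2024, §2.2 («`A^δ ≅ Λ/(1−δ)Λ`», chunk p0034)] [cite: Lange2023AbelianVarietiesComplex, §1.1.2 Prop. 1.1.13 and §2.4.1 Prop. 2.4.3 (b)] -/
theorem natCard_fixedPoints_eq_four {M : Matrix (Fin 4) (Fin 4) ℤ}
    (hJ : M.map (Int.cast : ℤ → ℝ) = jMatrix (period a b ha hb hτ) ∨
      M.map (Int.cast : ℤ → ℝ) = -jMatrix (period a b ha hb hτ)) :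
    Nat.card (fixedPoints (mapMatrix (period a b ha hb hτ) (period a b ha hb hτ) M)) = 4 := by
  rw [natCard_fixedPoints_mapMatrix, det_one_sub_eq_four ha hb hτ hJ]
  rfl

/-- **… and so does every translate `x ↦ ±J_τ x + c`** (`#Fix(t_c ∘ f) = |det(1 − ρ_r(f))|` is translation
invariant). [cite: FarmakisMoskowitz2013, §5.5.1 Thm. 5.5.5] [cite: Lange2023AbelianVarietiesComplex, §2.4.1 Prop. 2.4.3 (b)] -/
theorem natCard_fixedPoints_add_eq_four {M : Matrix (Fin 4) (Fin 4) ℤ}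
    (hJ : M.map (Int.cast : ℤ → ℝ) = jMatrix (period a b ha hb hτ) ∨
      M.map (Int.cast : ℤ → ℝ) = -jMatrix (period a b ha hb hτ))
    (c : ComplexTorus (period a b ha hb hτ)) :
    Nat.card (fixedPoints fun y ↦ mapMatrix (period a b ha hb hτ) (period a b ha hb hτ) M y + c) = 4 := by
  rw [natCard_fixedPoints_mapMatrix_add, det_one_sub_eq_four ha hb hτ hJ]
  rfl

/-- **`Fix(±J_τ) ⊆ A(τ)[2]`**: every fixed point of an order-`4` automorphism of `(A(τ), ι)` is `2`-torsion
(`Φ₄(1) = 2` kills `A^δ`). [cite: DolgachevZarhin2024, §2.2 («`A^δ` … is contained in `A[ℓ]`», chunk p0033)] -/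
theorem two_zsmul_eq_zero_of_mapMatrix_eq {M : Matrix (Fin 4) (Fin 4) ℤ}
    (hJ : M.map (Int.cast : ℤ → ℝ) = jMatrix (period a b ha hb hτ) ∨
      M.map (Int.cast : ℤ → ℝ) = -jMatrix (period a b ha hb hτ))
    {t : ComplexTorus (period a b ha hb hτ)} (ht : mapMatrix (period a b ha hb hτ) (period a b ha hb hτ) M t = t) :
    (2 : ℤ) • t = 0 := by
  have hD := aeval_cyclotomic_four_eq_zero (mul_self_eq_neg_one_of_map_eq ha hb hτ hJ)
  have h := eval_one_cyclotomic_zsmul_eq_zero (period a b ha hb hτ) hD ((mem_fixedSubgroup_iff _ _ t).2 ht)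
  rwa [eval_one_cyclotomic_prime_pow, Nat.cast_ofNat] at h

/-- **`Fix(J_τ) = Fix(−J_τ)`**: on the `2`-torsion points `u` and `−u` agree, and both fixed loci are `2`-torsion.
[cite: DolgachevZarhin2024, §2.2 (chunk p0033)] -/
theorem fixedPoints_eq_fixedPoints_neg {M : Matrix (Fin 4) (Fin 4) ℤ}
    (hJ : M.map (Int.cast : ℤ → ℝ) = jMatrix (period a b ha hb hτ) ∨
      M.map (Int.cast : ℤ → ℝ) = -jMatrix (period a b ha hb hτ)) :
    fixedPoints (mapMatrix (period a b ha hb hτ) (period a b ha hb hτ) M) =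
      fixedPoints (mapMatrix (period a b ha hb hτ) (period a b ha hb hτ) (-M)) := by
  have key : ∀ N : Matrix (Fin 4) (Fin 4) ℤ,
      (N.map (Int.cast : ℤ → ℝ) = jMatrix (period a b ha hb hτ) ∨
        N.map (Int.cast : ℤ → ℝ) = -jMatrix (period a b ha hb hτ)) →
      fixedPoints (mapMatrix (period a b ha hb hτ) (period a b ha hb hτ) N) ⊆
        fixedPoints (mapMatrix (period a b ha hb hτ) (period a b ha hb hτ) (-N)) := by
    intro N hN t ht
    have ht' : mapMatrix (period a b ha hb hτ) (period a b ha hb hτ) N t = t := ht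
    have h2 := two_zsmul_eq_zero_of_mapMatrix_eq ha hb hτ hN ht'
    show mapMatrix (period a b ha hb hτ) (period a b ha hb hτ) (-N) t = t
    rw [mapMatrix_neg, ht', neg_eq_iff_add_eq_zero, ← two_smul ℤ t, h2]
  refine Set.Subset.antisymm (key M hJ) ?_
  have h := key (-M) (by
    rw [map_intCast_neg_aux]
    rcases hJ with h | h
    · exact Or.inr (by rw [h])
    · exact Or.inl (by rw [h, neg_neg]))
  rwa [neg_neg] at h

/-- **Fixed-point census of `Aut(A(τ), ι)`**: a unit `u ≠ 1` of `End(A(τ), ι)` has `16` fixed points if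
`u = −1` (`A(τ)[2]`) and `4` fixed points otherwise (`ρ_r(u) = ±J_τ`, g27-#6 `map_coe_eq_or_of_isUnit`).
[cite: KudlaRapoportYang2006, §3.2 Prop. 3.2.1 (proof) p. 48 and §3.4 (3.4.7)] [cite: DolgachevZarhin2024, §2.2 (chunk p0034)] [cite: Lange2023AbelianVarietiesComplex, §1.1.2 («`X_n ≅ (ℤ/nℤ)^{2g}`») and Prop. 1.1.13] -/
theorem natCard_fixedPoints_of_isUnit {M : equivariantEndRingInt ha hb hτ} (hM : IsUnit M)
    (h1 : (M : Matrix (Fin 4) (Fin 4) ℤ) ≠ 1) :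
    ((M : Matrix (Fin 4) (Fin 4) ℤ) = -1 ∧
        Nat.card (fixedPoints (mapMatrix (period a b ha hb hτ) (period a b ha hb hτ) (M : Matrix (Fin 4) (Fin 4) ℤ))) = 16) ∨
      (((M : Matrix (Fin 4) (Fin 4) ℤ).map (Int.cast : ℤ → ℝ) = jMatrix (period a b ha hb hτ) ∨
          (M : Matrix (Fin 4) (Fin 4) ℤ).map (Int.cast : ℤ → ℝ) = -jMatrix (period a b ha hb hτ)) ∧
        Nat.card (fixedPoints (mapMatrix (period a b ha hb hτ) (period a b ha hb hτ) (M : Matrix (Fin 4) (Fin 4) ℤ))) = 4) := by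
  rcases map_coe_eq_or_of_isUnit ha hb hτ hM with h | h | h | h
  · exact absurd (Matrix.map_injective (Int.cast_injective (α := ℝ)) (by
      show (M : Matrix (Fin 4) (Fin 4) ℤ).map (Int.cast : ℤ → ℝ) = (1 : Matrix (Fin 4) (Fin 4) ℤ).map (Int.cast : ℤ → ℝ)
      rw [h, map_intCast_one_aux])) h1
  · left
    have hM1 : (M : Matrix (Fin 4) (Fin 4) ℤ) = -1 := Matrix.map_injective (Int.cast_injective (α := ℝ)) (by
      show (M : Matrix (Fin 4) (Fin 4) ℤ).map (Int.cast : ℤ → ℝ) = (-1 : Matrix (Fin 4) (Fin 4) ℤ).map (Int.cast : ℤ → ℝ)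
      rw [h, map_intCast_neg_aux, map_intCast_one_aux])
    refine ⟨hM1, ?_⟩
    rw [hM1, natCard_fixedPoints_mapMatrix, sub_neg_eq_add, ← two_smul ℤ (1 : Matrix (Fin 4) (Fin 4) ℤ),
      Matrix.det_smul, Matrix.det_one, mul_one, Fintype.card_fin]
    rfl
  · exact Or.inr ⟨Or.inl h, natCard_fixedPoints_eq_four ha hb hτ (Or.inl h)⟩
  · exact Or.inr ⟨Or.inr h, natCard_fixedPoints_eq_four ha hb hτ (Or.inr h)⟩

/-- **At a `Z(1)`-point** (`w(A(τ), ι) = 4`): `(A(τ), ι)` has an automorphism `u` with `u² = −1`, exactly `4`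
fixed points, all of them `2`-torsion. [cite: KudlaRapoportYang2006, §3.4 Def. 3.4.2, (3.4.6)–(3.4.7) and Remark 3.4.4] [cite: DolgachevZarhin2024, §2.2 (chunks p0033–p0034)] -/
theorem exists_natCard_fixedPoints_eq_four_of_natCard_eq_four (h4 : Nat.card (equivariantEndRingInt ha hb hτ)ˣ = 4) :
    ∃ M ∈ equivariantEndRingInt ha hb hτ, M * M = -1 ∧
      Nat.card (fixedPoints (mapMatrix (period a b ha hb hτ) (period a b ha hb hτ) M)) = 4 ∧
      ∀ t : ComplexTorus (period a b ha hb hτ),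
        mapMatrix (period a b ha hb hτ) (period a b ha hb hτ) M t = t → (2 : ℤ) • t = 0 := by
  obtain ⟨M, hM, hJ⟩ := (natCard_units_eq_four_iff_exists_map_coe_eq_jMatrix ha hb hτ).1 h4
  exact ⟨M, hM, mul_self_eq_neg_one_of_map_eq ha hb hτ (Or.inl hJ), natCard_fixedPoints_eq_four ha hb hτ (Or.inl hJ),
    fun t ht ↦ two_zsmul_eq_zero_of_mapMatrix_eq ha hb hτ (Or.inl hJ) ht⟩

end FixedPoints

/-! ## Validation: `(a, b) = (−1, 3)`, `τ = i` -/

section Validation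

/-- **`R_i` has exactly `4` fixed points on `A(i)`** (`(−1,3)` family; `ρ_r(R_i) = J`, g27-#5
`map_rmulInt_I_eq_jMatrix_neg_one_three_I`). [cite: KudlaRapoportYang2006, §3.4 (3.4.6) p. 51] [cite: DolgachevZarhin2024, §2.2 (chunk p0034)] -/
theorem natCard_fixedPoints_rmulInt_I_neg_one_three_I :
    Nat.card (fixedPoints (mapMatrix (period (-1) 3 (by norm_num) (by norm_num) im_I_ne_zero')
      (period (-1) 3 (by norm_num) (by norm_num) im_I_ne_zero') (rmulInt (-1) 3 ![0, 1, 0, 0]))) = 4 :=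
  natCard_fixedPoints_eq_four (a := -1) (b := 3) (by norm_num) (by norm_num) im_I_ne_zero'
    (Or.inl map_rmulInt_I_eq_jMatrix_neg_one_three_I)

/-- **… all of them `2`-torsion.** [cite: DolgachevZarhin2024, §2.2 (chunk p0033)] -/
theorem two_zsmul_eq_zero_of_rmulInt_I_neg_one_three_I {t : ComplexTorus (period (-1) 3 (by norm_num) (by norm_num) im_I_ne_zero')}
    (ht : mapMatrix (period (-1) 3 (by norm_num) (by norm_num) im_I_ne_zero')
      (period (-1) 3 (by norm_num) (by norm_num) im_I_ne_zero') (rmulInt (-1) 3 ![0, 1, 0, 0]) t = t) :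
    (2 : ℤ) • t = 0 :=
  two_zsmul_eq_zero_of_mapMatrix_eq (a := -1) (b := 3) (by norm_num) (by norm_num) im_I_ne_zero'
    (Or.inl map_rmulInt_I_eq_jMatrix_neg_one_three_I) ht

end Validation

end Literature.Geometry.Kaehler.ComplexTorus.QuaternionType
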